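import Literature.Topology.FourManifolds.BoundaryPlanarisation

/-!
# Spherical coordinates on the basin of the minimum

Topic `Literature/Topology/FourManifolds` (infrastructure for the Torelli half of Griffiths'
handlebody theorem, `stmt-SmoothPoincare4-15190`; first file of the *structure conjugacy* of two
one-level Morse data, DEHN-PLAN-2).  Everything here is **proved**; no named facts.

For a basin setting `B` of `(g, ξ)` on `(W; ∅, ∂W)` (`BasinSetting.lean`) every point `x` of the
basin of the minimum `p₀` other than `p₀`, of level `< hi`, lies on exactly one trajectory
through the small level sphere `{g = sphR}` (radius `rad` in Milnor's chart at `p₀`):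

* `BasinSetting.dir B x = toChart (levelProj θ sphR x)` — the **direction** of `x`, a chart vector of
  norm `rad` (`norm_dir`), constant along trajectories (`dir_θ`, `dir_levelProj`), smooth
  (`contMDiffAt_dir`); on the boundary `dir (push y) = planar y` (`dir_push`);
* `BasinSetting.conePt B v ℓ = levelProj θ ℓ (ofChart v)` — the **cone point** of direction `v` and
  level `ℓ`, the inverse coordinate map: `conePt (dir x) (g x) = x` (`conePt_dir`),
  `dir (conePt v ℓ) = v`, `g (conePt v ℓ) = ℓ` (`dir_conePt`, `apply_conePt`), jointly smooth in
  `(v, ℓ)` (`contMDiffAt_conePt_prod`); below the chart sphere the cone points are the rays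
  `conePt v ℓ = ofChart ((√(ℓ - g p₀) / rad) • v)` (`conePt_eq_ofChart_smul`);
* every basin point `≠ p₀` of level `≤ hi` meets the small sphere (`hits_sphR_of_mem_basin`), and
  levels between the point and a level it meets are met (`hits_of_le_of_le`, `hits_of_ge_of_ge`).

So `x ↦ (dir x, g x)` is a diffeomorphism of `basin ∖ {p₀} ∩ {g < hi}` onto the open subset
`{(v, ℓ) : ‖v‖ = rad, the ray of v meets ℓ}` of `S_rad × ℝ` — Milnor's product structure along
the trajectories (Thm. 3.4), read from the minimum.

## References

* J. Milnor, *Lectures on the h-cobordism theorem* (1965), Def. 3.9, Thm. 3.4, Thm. 4.1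
  (PDF pp. 12–13, 16, 22). [MilnorHCobordism1965]
-/

open scoped Manifold ContDiff Topology
open Set Function Filter Metric

noncomputable section

namespace Literature.Topology.FourManifolds

open Cobordism FourManifolds.Flow

universe u

namespace BasinSetting

variable {n : ℕ} {W : Type u} [TopologicalSpace W] [T2Space W] [SecondCountableTopology W]
  [CompactSpace W] [ChartedSpace (EuclideanHalfSpace (n + 1)) W] [IsManifold (𝓡∂ (n + 1)) ∞ W]
  {g : W → ℝ} {ξ : Π x : W, TangentSpace (𝓡∂ (n + 1)) x} {B : BasinSetting g ξ}

/-! ### Hitting intermediate levels -/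

/-- **Levels between the point and a level it meets are met** (upwards). [folklore] -/
theorem hits_of_le_of_le {x : W} {ℓ ℓ' : ℝ} (hh : Hits B.θ g ℓ' x) (h1 : g x ≤ ℓ) (h2 : ℓ ≤ ℓ') :
    Hits B.θ g ℓ x := by
  obtain ⟨t, ht⟩ := hh
  rcases le_total 0 t with ht0 | ht0
  · have hmem : ℓ ∈ Icc (g (B.θ (0, x))) (g (B.θ (t, x))) := ⟨by rw [B.θ_zero]; exact h1, by rw [ht]; exact h2⟩
    obtain ⟨s, -, hs⟩ := intermediate_value_Icc ht0 (B.continuous_apply_θ x).continuousOn hmem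
    exact ⟨s, hs⟩
  · have hle : g (B.θ (t, x)) ≤ g x := B.apply_θ_le ht0
    have heq : ℓ = g x := le_antisymm (h2.trans (by rw [ht] at hle; exact hle)) h1
    exact ⟨0, by rw [B.θ_zero, heq]⟩

/-- **Levels between a level it meets and the point are met** (downwards). [folklore] -/
theorem hits_of_ge_of_ge {x : W} {ℓ ℓ' : ℝ} (hh : Hits B.θ g ℓ' x) (h1 : ℓ ≤ g x) (h2 : ℓ' ≤ ℓ) :
    Hits B.θ g ℓ x := by
  obtain ⟨t, ht⟩ := hh
  rcases le_total t 0 with ht0 | ht0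
  · have hmem : ℓ ∈ Icc (g (B.θ (t, x))) (g (B.θ (0, x))) := ⟨by rw [ht]; exact h2, by rw [B.θ_zero]; exact h1⟩
    obtain ⟨s, -, hs⟩ := intermediate_value_Icc ht0 (B.continuous_apply_θ x).continuousOn hmem
    exact ⟨s, hs⟩
  · have hle : g x ≤ g (B.θ (t, x)) := B.le_apply_θ ht0
    have heq : ℓ = g x := le_antisymm h1 (by rw [ht] at hle; exact hle.trans h2)
    exact ⟨0, by rw [B.θ_zero, heq]⟩

/-- A point meets its own level. [folklore] -/
theorem hits_self (x : W) : Hits B.θ g (g x) x := ⟨0, by rw [B.θ_zero]⟩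

/-- **The rays of the chart ball meet every level of `(g p₀, sph)`.** [cite: MilnorHCobordism1965, Def. 3.1 (2), Def. 3.9] -/
theorem hits_ofChart_of_mem_Ioo {v : EuclideanSpace ℝ (Fin (n + 1))} (hv0 : v ≠ 0) (hv : ‖v‖ < B.r₀)
    {ℓ : ℝ} (hℓ : ℓ ∈ Ioo (g B.p₀) B.sph) : Hits B.θ g ℓ (B.ofChart v) := by
  have hvn : 0 < ‖v‖ := norm_pos_iff.2 hv0
  set c : ℝ := Real.sqrt (ℓ - g B.p₀) / ‖v‖ with hc
  have hℓ0 : 0 < ℓ - g B.p₀ := by linarith [hℓ.1]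
  have hsq : Real.sqrt (ℓ - g B.p₀) < B.r₀ := by
    rw [Real.sqrt_lt' B.r₀_pos]; unfold sph at hℓ; linarith [hℓ.2]
  have hcpos : 0 < c := div_pos (Real.sqrt_pos.2 hℓ0) hvn
  have hcv : c * ‖v‖ = Real.sqrt (ℓ - g B.p₀) := by rw [hc, div_mul_cancel₀ _ hvn.ne']
  have hnorm : ‖c • v‖ = Real.sqrt (ℓ - g B.p₀) := by
    rw [norm_smul, Real.norm_of_nonneg hcpos.le, hcv]
  have hlevel : g (B.ofChart (c • v)) = ℓ := by
    rw [B.apply_ofChart (by rw [hnorm]; exact hsq.le), hnorm, Real.sq_sqrt hℓ0.le]; ring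
  refine ⟨Real.log c, ?_⟩
  rcases le_total c 1 with hc1 | hc1
  · rw [B.θ_ofChart hv (Real.log_nonpos hcpos.le hc1), Real.exp_log hcpos, hlevel]
  · rw [B.θ_ofChart' (Real.log_nonneg hc1) (by rw [Real.exp_log hcpos, hcv]; exact hsq), Real.exp_log hcpos,
      hlevel]

/-- **Every basin point other than `p₀`, of level `≤ hi`, meets the small level sphere.** [cite: MilnorHCobordism1965, Def. 3.9, Thm. 3.4] -/
theorem hits_sphR_of_mem_basin {x : W} (hx : x ∈ B.basin) (hx0 : x ≠ B.p₀) (hxhi : g x ≤ B.hi) :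
    Hits B.θ g B.sphR x := by
  by_cases h : B.sphR ≤ g x
  · obtain ⟨t, -, ht⟩ := B.exists_apply_θ_eq_of_mem_basin hx hxhi ⟨B.sphR_mem_Ioo.1, h⟩
    exact ⟨t, ht⟩
  · have hxs : g x < B.sph := (not_le.1 h).trans B.sphR_lt_sph
    have hx' : B.ofChart (B.toChart x) = x := B.ofChart_toChart_of_apply_le hxs.le
    have hv0 : B.toChart x ≠ 0 := by
      intro h0; apply hx0; rw [← hx', h0, B.ofChart_zero]
    have hvr : ‖B.toChart x‖ < B.r₀ := by
      have h1 := B.norm_toChart_sq hxs.le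
      have h2 : ‖B.toChart x‖ ^ 2 < B.r₀ ^ 2 := by rw [h1]; unfold sph at hxs; linarith
      exact (pow_lt_pow_iff_left₀ (norm_nonneg _) B.r₀_pos.le two_ne_zero).1 h2
    rw [← hx']
    exact B.hits_ofChart_of_mem_Ioo hv0 hvr ⟨B.sphR_mem_Ioo.1, B.sphR_lt_sph⟩

/-! ### The direction of a basin point -/

variable (B) in
/-- **The direction** of a point: the chart vector of the point of its trajectory on the small
level sphere `{g = sphR}`. [cite: MilnorHCobordism1965, Def. 3.9, Thm. 3.4] -/
def dir (x : W) : EuclideanSpace ℝ (Fin (n + 1)) := B.toChart (levelProj B.θ g B.sphR x)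

/-- Unfolding `dir`. [folklore] -/
theorem dir_def (x : W) : B.dir x = B.toChart (levelProj B.θ g B.sphR x) := rfl

/-- **On the boundary the direction is the planarisation**: `dir (push y) = planar y`. [folklore] -/
theorem dir_push (y : (𝓡∂ (n + 1)).boundary W) : B.dir (B.push (y : W)) = B.planar y := rfl

/-- The level point on the small sphere lies in the chart domain. [folklore] -/
theorem levelProj_sphR_mem_source {x : W} (hx : Hits B.θ g B.sphR x) : levelProj B.θ g B.sphR x ∈ B.φ.source :=
  B.mem_source_of_apply_le (by rw [B.apply_levelProj hx]; exact B.sphR_le_sph)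

/-- **The direction has norm `rad`.** [folklore] -/
theorem norm_dir {x : W} (hx : Hits B.θ g B.sphR x) : ‖B.dir x‖ = B.rad :=
  (B.norm_toChart_eq_rad_iff (by rw [B.apply_levelProj hx]; exact B.sphR_le_sph)).2 (B.apply_levelProj hx)

/-- The chart point of the direction is the level point on the small sphere. [folklore] -/
theorem ofChart_dir {x : W} (hx : Hits B.θ g B.sphR x) : B.ofChart (B.dir x) = levelProj B.θ g B.sphR x :=
  B.ofChart_toChart (levelProj_sphR_mem_source hx)

/-- **The direction is constant along trajectories.** [folklore] -/
theorem dir_θ {x : W} (hnc : ¬ IsMCriticalPt (𝓡∂ (n + 1)) g x) (hx : Hits B.θ g B.sphR x) (t : ℝ) :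
    B.dir (B.θ (t, x)) = B.dir x := by
  rw [dir_def, dir_def, B.levelProj_θ hnc (Ioo_subset_Icc_self B.sphR_mem_Ioo_lo) hx t]

/-- The direction of a level point is the direction of the point. [folklore] -/
theorem dir_levelProj {x : W} (hnc : ¬ IsMCriticalPt (𝓡∂ (n + 1)) g x) (hx : Hits B.θ g B.sphR x) (ℓ : ℝ) :
    B.dir (levelProj B.θ g ℓ x) = B.dir x := by
  rw [dir_def, dir_def, B.levelProj_levelProj hnc ℓ (Ioo_subset_Icc_self B.sphR_mem_Ioo_lo) hx]

/-- A chart point of norm `rad` is not critical. [folklore] -/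
theorem not_isMCriticalPt_ofChart {v : EuclideanSpace ℝ (Fin (n + 1))} (hv : ‖v‖ = B.rad) :
    ¬ IsMCriticalPt (𝓡∂ (n + 1)) g (B.ofChart v) :=
  B.not_isMCriticalPt_of_mem (by
    rw [(B.apply_ofChart_eq_sphR_iff (B.norm_lt_r₀_of_eq_rad hv).le).2 hv]
    exact ⟨B.sphR_mem_Ioo.1, B.sphR_le_sph⟩)

/-- **The direction of a point of the small sphere is its chart vector**: `dir (ofChart v) = v`. [folklore] -/
theorem dir_ofChart {v : EuclideanSpace ℝ (Fin (n + 1))} (hv : ‖v‖ = B.rad) : B.dir (B.ofChart v) = v := by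
  have hvr : ‖v‖ < B.r₀ := B.norm_lt_r₀_of_eq_rad hv
  rw [dir_def, B.levelProj_eq_self (B.not_isMCriticalPt_ofChart hv) (Ioo_subset_Icc_self B.sphR_mem_Ioo_lo)
    ((B.apply_ofChart_eq_sphR_iff hvr.le).2 hv), B.toChart_ofChart hvr.le]

/-- **The direction is smooth** at the non-critical points of the slab meeting the small sphere. [cite: MilnorHCobordism1965, proof of Thm. 5.4, Assertion 4 (PDF p. 29)] -/
theorem contMDiffAt_dir {x : W} (hgx : g x ∈ Icc B.lo B.hi) (hnc : ¬ IsMCriticalPt (𝓡∂ (n + 1)) g x)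
    (hx : Hits B.θ g B.sphR x) :
    ContMDiffAt (𝓡∂ (n + 1)) 𝓘(ℝ, EuclideanSpace ℝ (Fin (n + 1))) ∞ B.dir x :=
  (B.contMDiffAt_toChart (levelProj_sphR_mem_source hx)).comp x (B.contMDiffAt_levelProj hgx hnc B.sphR_mem_Ioo_lo hx)

/-! ### Cone points -/

variable (B) in
/-- **The cone point** of direction `v` and level `ℓ`: the point of level `ℓ` on the trajectory
through the chart point `ofChart v`. [cite: MilnorHCobordism1965, Def. 3.9, Thm. 3.4] -/
def conePt (v : EuclideanSpace ℝ (Fin (n + 1))) (ℓ : ℝ) : W := levelProj B.θ g ℓ (B.ofChart v)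

/-- Unfolding `conePt`. [folklore] -/
theorem conePt_def (v : EuclideanSpace ℝ (Fin (n + 1))) (ℓ : ℝ) : B.conePt v ℓ = levelProj B.θ g ℓ (B.ofChart v) := rfl

/-- **The cone point has the prescribed level.** [folklore] -/
theorem apply_conePt {v : EuclideanSpace ℝ (Fin (n + 1))} {ℓ : ℝ} (h : Hits B.θ g ℓ (B.ofChart v)) :
    g (B.conePt v ℓ) = ℓ := B.apply_levelProj h

/-- **The cone point has the prescribed direction.** [folklore] -/
theorem dir_conePt {v : EuclideanSpace ℝ (Fin (n + 1))} (hv : ‖v‖ = B.rad) (ℓ : ℝ) : B.dir (B.conePt v ℓ) = v := by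
  rw [conePt_def, B.dir_levelProj (B.not_isMCriticalPt_ofChart hv)
    ⟨0, by rw [B.θ_zero]; exact (B.apply_ofChart_eq_sphR_iff (B.norm_lt_r₀_of_eq_rad hv).le).2 hv⟩, B.dir_ofChart hv]

/-- **The point is the cone point of its direction and level.** [folklore] -/
theorem conePt_dir {x : W} (hgx : g x ∈ Icc B.lo B.hi) (hnc : ¬ IsMCriticalPt (𝓡∂ (n + 1)) g x)
    (hx : Hits B.θ g B.sphR x) : B.conePt (B.dir x) (g x) = x := by
  rw [conePt_def, B.ofChart_dir hx, B.levelProj_levelProj hnc _ hgx (B.hits_self x), B.levelProj_eq_self hnc hgx rfl]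

/-- More generally the cone point of the direction of `x` at a level met by `x` is the level
point of `x`. [folklore] -/
theorem conePt_dir_eq_levelProj {x : W} (hnc : ¬ IsMCriticalPt (𝓡∂ (n + 1)) g x) (hx : Hits B.θ g B.sphR x)
    {ℓ : ℝ} (hℓ : ℓ ∈ Icc B.lo B.hi) (hh : Hits B.θ g ℓ x) : B.conePt (B.dir x) ℓ = levelProj B.θ g ℓ x := by
  rw [conePt_def, B.ofChart_dir hx, B.levelProj_levelProj hnc _ hℓ hh]

/-- A level met by the chart point of `v` is met by every cone point of `v` (and conversely). [folklore] -/
theorem hits_conePt_iff (v : EuclideanSpace ℝ (Fin (n + 1))) (ℓ ℓ' : ℝ) :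
    Hits B.θ g ℓ' (B.conePt v ℓ) ↔ Hits B.θ g ℓ' (B.ofChart v) := B.hits_levelProj_iff _ _ _

/-- **Cone points of the same direction**: the cone point at level `ℓ'` of the cone point at
level `ℓ` is the cone point at level `ℓ'`. [folklore] -/
theorem levelProj_conePt {v : EuclideanSpace ℝ (Fin (n + 1))} (hv : ‖v‖ = B.rad) (ℓ : ℝ) {ℓ' : ℝ}
    (hℓ' : ℓ' ∈ Icc B.lo B.hi) (hh : Hits B.θ g ℓ' (B.ofChart v)) :
    levelProj B.θ g ℓ' (B.conePt v ℓ) = B.conePt v ℓ' := by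
  rw [conePt_def, conePt_def, B.levelProj_levelProj (B.not_isMCriticalPt_ofChart hv) ℓ hℓ' hh]

/-- **The spherical coordinates are injective**: cone points with directions of norm `rad` at met
levels coincide only if directions and levels do. [folklore] -/
theorem conePt_eq_conePt_iff {v v' : EuclideanSpace ℝ (Fin (n + 1))} (hv : ‖v‖ = B.rad) (hv' : ‖v'‖ = B.rad)
    {ℓ ℓ' : ℝ} (hℓ : Hits B.θ g ℓ (B.ofChart v)) (hℓ' : Hits B.θ g ℓ' (B.ofChart v')) :
    B.conePt v ℓ = B.conePt v' ℓ' ↔ v = v' ∧ ℓ = ℓ' := by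
  constructor
  · intro h
    refine ⟨?_, ?_⟩
    · rw [← B.dir_conePt hv ℓ, h, B.dir_conePt hv' ℓ']
    · rw [← B.apply_conePt hℓ, h, B.apply_conePt hℓ']
  · rintro ⟨rfl, rfl⟩; rfl

/-- **Cone points lie in the basin** (levels `≤ hi`). [cite: MilnorHCobordism1965, Def. 3.9] -/
theorem conePt_mem_basin {v : EuclideanSpace ℝ (Fin (n + 1))} (hv : ‖v‖ = B.rad) {ℓ : ℝ} (hℓ : ℓ ≤ B.hi)
    (hh : Hits B.θ g ℓ (B.ofChart v)) : B.conePt v ℓ ∈ B.basin := by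
  have hvr : ‖v‖ < B.r₀ := B.norm_lt_r₀_of_eq_rad hv
  rw [conePt_def, levelProj_apply]
  refine (B.θ_mem_basin_iff ?_ ?_).2 (B.ofChart_mem_basin hvr)
  · exact ((B.apply_ofChart_lt_sph hvr).trans (B.sph_lt_L.trans B.L_lt_hi)).le
  · show g (levelProj B.θ g ℓ (B.ofChart v)) ≤ B.hi
    rw [B.apply_levelProj hh]; exact hℓ

/-- A cone point at a level above `g p₀` is not the minimum. [folklore] -/
theorem conePt_ne_p₀ {v : EuclideanSpace ℝ (Fin (n + 1))} {ℓ : ℝ} (hℓ : g B.p₀ < ℓ) (hh : Hits B.θ g ℓ (B.ofChart v)) :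
    B.conePt v ℓ ≠ B.p₀ := fun h => by
  have := B.apply_conePt hh; rw [h] at this; linarith

/-- **Below the chart sphere the cone points are the rays**:
`conePt v ℓ = ofChart ((√(ℓ - g p₀) / rad) • v)` for `ℓ ∈ (g p₀, sph)`. [cite: MilnorHCobordism1965, Def. 3.1 (2), proof of Thm. 3.12] -/
theorem conePt_eq_ofChart_smul {v : EuclideanSpace ℝ (Fin (n + 1))} (hv : ‖v‖ = B.rad) {ℓ : ℝ}
    (hℓ : ℓ ∈ Ioo (g B.p₀) B.sph) : B.conePt v ℓ = B.ofChart ((Real.sqrt (ℓ - g B.p₀) / B.rad) • v) := by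
  have hvr : ‖v‖ < B.r₀ := B.norm_lt_r₀_of_eq_rad hv
  have hrad := B.rad_pos
  have hℓ0 : 0 < ℓ - g B.p₀ := by linarith [hℓ.1]
  have hsq : Real.sqrt (ℓ - g B.p₀) < B.r₀ := by
    rw [Real.sqrt_lt' B.r₀_pos]; unfold sph at hℓ; linarith [hℓ.2]
  set c : ℝ := Real.sqrt (ℓ - g B.p₀) / B.rad with hc
  have hcpos : 0 < c := div_pos (Real.sqrt_pos.2 hℓ0) hrad
  have hcv : c * ‖v‖ = Real.sqrt (ℓ - g B.p₀) := by rw [hv, hc, div_mul_cancel₀ _ hrad.ne']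
  have hnorm : ‖c • v‖ = Real.sqrt (ℓ - g B.p₀) := by rw [norm_smul, Real.norm_of_nonneg hcpos.le, hcv]
  have hlevel : g (B.ofChart (c • v)) = ℓ := by
    rw [B.apply_ofChart (by rw [hnorm]; exact hsq.le), hnorm, Real.sq_sqrt hℓ0.le]; ring
  have hθ : B.θ (Real.log c, B.ofChart v) = B.ofChart (c • v) := by
    rcases le_total c 1 with hc1 | hc1
    · rw [B.θ_ofChart hvr (Real.log_nonpos hcpos.le hc1), Real.exp_log hcpos]
    · rw [B.θ_ofChart' (Real.log_nonneg hc1) (by rw [Real.exp_log hcpos, hcv]; exact hsq), Real.exp_log hcpos]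
  rw [conePt_def, B.levelProj_eq_θ_of_apply_eq (B.not_isMCriticalPt_ofChart hv)
    (Ioo_subset_Icc_self (B.Ioo_subset_Ioo_lo ⟨hℓ.1, hℓ.2.trans (B.sph_lt_L.trans B.L_lt_hi)⟩))
    (t := Real.log c) (by rw [hθ, hlevel]), hθ]

/-- In particular at the level `sphR` the cone point is the chart point: `conePt v sphR = ofChart v`. [folklore] -/
theorem conePt_sphR {v : EuclideanSpace ℝ (Fin (n + 1))} (hv : ‖v‖ = B.rad) : B.conePt v B.sphR = B.ofChart v := by
  rw [conePt_def, B.levelProj_eq_self (B.not_isMCriticalPt_ofChart hv) (Ioo_subset_Icc_self B.sphR_mem_Ioo_lo)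
    ((B.apply_ofChart_eq_sphR_iff (B.norm_lt_r₀_of_eq_rad hv).le).2 hv)]

/-- **The cone point is jointly smooth in direction and level** (chart vectors of norm in
`(0, r₀)`, levels of the open slab met by the ray). [cite: MilnorHCobordism1965, Thm. 4.1 (PDF p. 22); proof of Thm. 5.4, Assertion 4 (PDF p. 29)] -/
theorem contMDiffAt_conePt_prod {v₀ : EuclideanSpace ℝ (Fin (n + 1))} (hv₀ : v₀ ≠ 0) (hv₀r : ‖v₀‖ < B.r₀) {ℓ₀ : ℝ}
    (hℓ₀ : ℓ₀ ∈ Ioo B.lo B.hi) (hh : Hits B.θ g ℓ₀ (B.ofChart v₀)) :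
    ContMDiffAt (𝓘(ℝ, EuclideanSpace ℝ (Fin (n + 1))).prod 𝓘(ℝ, ℝ)) (𝓡∂ (n + 1)) ∞
      (fun p : EuclideanSpace ℝ (Fin (n + 1)) × ℝ => B.conePt p.1 p.2) (v₀, ℓ₀) := by
  have hgx : g (B.ofChart v₀) ∈ Ioc (g B.p₀) B.sph := by
    rw [B.apply_ofChart hv₀r.le]
    have hvpos : 0 < ‖v₀‖ := norm_pos_iff.2 hv₀
    refine ⟨by nlinarith [sq_nonneg ‖v₀‖, mul_pos hvpos hvpos], ?_⟩
    unfold sph; gcongr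
  have hnc : ¬ IsMCriticalPt (𝓡∂ (n + 1)) g (B.ofChart v₀) := B.not_isMCriticalPt_of_mem hgx
  have hslab : g (B.ofChart v₀) ∈ Icc B.lo B.hi := B.apply_mem_slab (hgx.2.trans_lt (B.sph_lt_L.trans B.L_lt_hi))
  have h1 : ContMDiffAt (𝓘(ℝ, EuclideanSpace ℝ (Fin (n + 1))).prod 𝓘(ℝ, ℝ)) ((𝓡∂ (n + 1)).prod 𝓘(ℝ, ℝ)) ∞
      (fun p : EuclideanSpace ℝ (Fin (n + 1)) × ℝ => (B.ofChart p.1, p.2)) (v₀, ℓ₀) :=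
    (B.contMDiffAt_ofChart hv₀r).prodMap contMDiffAt_id
  have h2 := (B.contMDiffAt_levelProj_prod hslab hnc hℓ₀ hh).comp (v₀, ℓ₀) h1
  exact h2

/-- The cone point at a fixed met level is smooth in the direction. [folklore] -/
theorem contMDiffAt_conePt {v₀ : EuclideanSpace ℝ (Fin (n + 1))} (hv₀ : v₀ ≠ 0) (hv₀r : ‖v₀‖ < B.r₀) {ℓ₀ : ℝ}
    (hℓ₀ : ℓ₀ ∈ Ioo B.lo B.hi) (hh : Hits B.θ g ℓ₀ (B.ofChart v₀)) :
    ContMDiffAt 𝓘(ℝ, EuclideanSpace ℝ (Fin (n + 1))) (𝓡∂ (n + 1)) ∞ (fun v => B.conePt v ℓ₀) v₀ := by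
  have h1 : ContMDiffAt 𝓘(ℝ, EuclideanSpace ℝ (Fin (n + 1))) (𝓘(ℝ, EuclideanSpace ℝ (Fin (n + 1))).prod 𝓘(ℝ, ℝ)) ∞
      (fun v : EuclideanSpace ℝ (Fin (n + 1)) => (v, ℓ₀)) v₀ := contMDiffAt_id.prodMk contMDiffAt_const
  have h2 := (B.contMDiffAt_conePt_prod hv₀ hv₀r hℓ₀ hh).comp v₀ h1
  exact h2

/-! ### Basin points are cone points -/

/-- **Every basin point other than `p₀`, of level `< hi`, is the cone point of its direction and
level**, with direction of norm `rad` whose ray meets that level. [cite: MilnorHCobordism1965, Thm. 3.4] -/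
theorem exists_eq_conePt_of_mem_basin {x : W} (hx : x ∈ B.basin) (hx0 : x ≠ B.p₀) (hxhi : g x < B.hi) :
    ‖B.dir x‖ = B.rad ∧ Hits B.θ g (g x) (B.ofChart (B.dir x)) ∧ B.conePt (B.dir x) (g x) = x := by
  have hhit : Hits B.θ g B.sphR x := B.hits_sphR_of_mem_basin hx hx0 hxhi.le
  have hnc : ¬ IsMCriticalPt (𝓡∂ (n + 1)) g x := B.not_isMCriticalPt_of_mem_basin hx hx0 hxhi.le
  refine ⟨B.norm_dir hhit, ?_, B.conePt_dir (B.apply_mem_slab hxhi) hnc hhit⟩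
  rw [B.ofChart_dir hhit, B.hits_levelProj_iff]
  exact B.hits_self x

end BasinSetting

end Literature.Topology.FourManifolds
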